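import Summits.KontsevichZagierPeriods.Zeta5Search.WedgeDictionaryQPart
import HarnessLib

/-!
# The open half of the wedge dictionary is EXACTLY the explicit `(P̂, P)`-identification (cell `pub-zeta5`, gen-1 g9)

HONEST FRAMING: systematic search; no irrationality claim unless certified.

`wedgeDictionaryIntegralPart` (`WedgeDictionaryQPart`, `@[conjecture]`, internally minted) is the cellular-integral half of the
wedge dictionary.  Substituting the PROVED decomposition `F̃₇(b) = U(b)ζ(5) + W(b)ζ(3) − V(b)` (`vwp_decomposition`) at `b` and
`b′ = b + e_j` and the PROVED `Q`-half (`wedgeDictionary_Q`), its right-hand side is Brown–Zudilin's shape (4),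
`Q(a)(2ζ(5) + 4ζ(3)ζ(2)) − 4P̂ζ(2) − 2P`, with the EXPLICIT minors `P̂ = ρ(a)(U V′ − U′ V)` and `P = ρ(a)(W′ V − W V′)`
(`cellularIntegral_eq_of_wedgeDictionary`, `WedgeDictionaryConsequences`, is the forward direction under the full conjecture).
This file records the EQUIVALENCE (`wedgeDictionaryIntegralPart_iff_explicitPQ`): the conjecture holds iff the cellular integral
has these explicit `P̂(a)`, `P(a)` — so, after the algebraic programme (CF-Q, CF-M3, the level-descent identities for `U∧V`),
what remains is purely on the Brown–Zudilin side: identifying THEIR `P̂(a)`, `P(a)` (obtained in arXiv:2210.03391 §3–5 from the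
double Barnes integral (16) by partial fractions; no closed formula for `P` is printed) with these minors.  Nothing here is
evidence for the conjecture; it is a reformulation with proof.
-/

noncomputable section

open Finset

namespace Summit.KontsevichZagierPeriods.Zeta5Search.WedgeDictionary

open Summit.KontsevichZagierPeriods.Zeta5Search.DualSeries
open Literature.NumberTheory.Irrationality.BrownZudilin2022 (vwpDual bOfA Converges cellularIntegral QOf)
open Literature.NumberTheory.Transcendental (zetaValue)

/-- **The explicit `(P̂, P)` form of BZ (4) on the conjecture's region (INTERNALLY MINTED; EQUIVALENT to the open
`wedgeDictionaryIntegralPart` by `wedgeDictionaryIntegralPart_iff_explicitPQ` below — not a new claim and not evidence):** for `a`, `j`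
as in `wedgeDictionary`, with `b = b(a)`, `b′ = b + e_j`, `I(a) = Q(a)(2ζ(5) + 4ζ(3)ζ(2)) − 4ρ(UV′ − U′V)ζ(2) − 2ρ(W′V − WV′)`. -/
@[conjecture] def explicitPQ : Prop :=
  ∀ (a : Fin 8 → ℤ) (j : ℕ), j ∈ Icc 1 7 → Converges a →
    (∀ i ∈ Icc 1 7, 0 ≤ bOfA a i ∧ 2 * bOfA a i ≤ bOfA a 0 + 1) → 0 ≤ dOf (bOfA a) →
    2 * (bOfA a j + 1) ≤ bOfA a 0 + 1 →
    cellularIntegral a =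
      (QOf a : ℝ) * (2 * zetaValue 5 + 4 * zetaValue 3 * zetaValue 2) -
        4 * ((rhoOf a * (coeffU (bOfA a) * coeffV (Function.update (bOfA a) j (bOfA a j + 1)) -
              coeffU (Function.update (bOfA a) j (bOfA a j + 1)) * coeffV (bOfA a)) : ℚ) : ℝ) * zetaValue 2 -
        2 * ((rhoOf a * (coeffW (Function.update (bOfA a) j (bOfA a j + 1)) * coeffV (bOfA a) -
              coeffW (bOfA a) * coeffV (Function.update (bOfA a) j (bOfA a j + 1))) : ℚ) : ℝ)

/-- **`wedgeDictionaryIntegralPart ↔ explicitPQ`**: the integral half of the wedge dictionary holds iff the cellular integral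
has BZ's shape (4) with the explicit minors `P̂ = ρ(UV′ − U′V)`, `P = ρ(W′V − WV′)` (both directions are the proved
decomposition `vwp_decomposition` at `b`, `b′` plus the proved `Q`-half `wedgeDictionary_Q`, and `ring`). -/
theorem wedgeDictionaryIntegralPart_iff_explicitPQ : wedgeDictionaryIntegralPart ↔ explicitPQ := by
  constructor
  · intro h a j hj hconv hreg hd hpart
    exact cellularIntegral_eq_of_wedgeDictionary (wedgeDictionary_iff_integralPart.2 h) a hj hconv hreg hd hpart
  · intro h a j hj hconv hreg hd hpart
    have hI := h a j hj hconv hreg hd hpart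
    have hQ := wedgeDictionary_Q a j hj hconv hreg hd hpart
    set b := bOfA a with hb
    set b' := Function.update b j (b j + 1) with hb'
    have hbox := inBox_of_region b hreg hj hpart
    obtain ⟨hbox', hsum'⟩ := region_update b hreg hd hj hpart
    have h1 := (vwp_decomposition b hbox (sum_le_of_dOf b hd)).2
    have h2 := (vwp_decomposition b' hbox' hsum').2
    have hQ' : ((QOf a : ℤ) : ℝ) = (rhoOf a : ℝ) * ((coeffU b : ℝ) * coeffW b' - coeffU b' * coeffW b) := by
      have h := congrArg (fun q : ℚ => (q : ℝ)) hQ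
      push_cast at h
      exact h
    show cellularIntegral a = _
    rw [hI, h1, h2]
    push_cast
    rw [hQ']
    ring

/-- Hence the wedge dictionary itself is equivalent to the explicit `(P̂, P)` form (its `Q`-half being proved). -/
theorem wedgeDictionary_iff_explicitPQ : wedgeDictionary ↔ explicitPQ :=
  wedgeDictionary_iff_integralPart.trans wedgeDictionaryIntegralPart_iff_explicitPQ

end Summit.KontsevichZagierPeriods.Zeta5Search.WedgeDictionary
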